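import Literature.NumberTheory.LFunctions.SiegelZeroFormSumAsymptoticProofs
import Literature.NumberTheory.LFunctions.SiegelZeroFormSumAsymptoticTheoremOneProofs
import HarnessLib

/-!
# Goldfeld–Schinzel 1975, Theorem 1: the tree's conditional consequences made unconditional

`SiegelZeroFormSumAsymptoticProofs.lean` derives, MODULO the named fact
`goldfeldSchinzel1975_theorem1` (hypothesis `h : goldfeldSchinzel1975_theorem1`), the odd-character
consequences of Goldfeld–Schinzel's Theorem 1 (Ann. SNS Pisa (4) 2 (1975), Thm 1 p. 571 with §4
p. 582): the Siegel-zero quality bound `η ≤ √D/((6/π − ε) log D)` and the upper bound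
`1 − β ≤ (6/π + η) h(−D)/√D` for the zero of the window. `SiegelZeroFormSumAsymptoticTheoremOneProofs.lean`
PROVES the fact (`goldfeldSchinzel1975_theorem1_holds`); this file feeds it in. (The odd half of the
Corollary itself is the tree's unconditional `goldfeldSchinzel1975_corollary_odd`,
`RealZeroRepulsionOddClassSum.lean`, by another road; `corollary_odd` below is the same statement
obtained from Theorem 1 as printed.)

## References
- [GoldfeldSchinzel1975] D. Goldfeld, A. Schinzel, *On Siegel's zero*, Ann. SNS Pisa (4) 2 (1975) 571–583, Thm 1, Corollary, §4.
- [TaoTeravainen2021] T. Tao, J. Teräväinen, *The Hardy–Littlewood–Chowla conjecture in the presence of a Siegel zero*, Definition 1.4.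
- [Cox2013] D. A. Cox, *Primes of the form x² + ny²*, 2nd ed., §7.B Thm 7.7.
-/

noncomputable section

open scoped Classical

namespace Literature.NumberTheory.LFunctions.GoldfeldSchinzel1975

open Literature.NumberTheory.QuadraticFields

/-- **Corollary (`d < 0`) from Theorem 1, unconditionally**: for `η > 0` there is `c` with
`1 − β ≥ (6/π − η)/√D` for every primitive quadratic odd `χ` mod `D > c` and every real zero `β`.
[cite: GoldfeldSchinzel1975, Corollary p. 572 (case d < 0), proof §4 p. 582] -/
theorem corollary_odd {η : ℝ} (hη : 0 < η) :
    ∃ c : ℕ, ∀ (D : ℕ) [NeZero D], c < D →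
      ∀ χ : DirichletCharacter ℂ D, χ.IsQuadratic → χ.IsPrimitive → χ.Odd →
        ∀ β : ℝ, χ.LFunction (β : ℂ) = 0 → (6 / Real.pi - η) / Real.sqrt D ≤ 1 - β :=
  corollary_odd_of_theorem1 goldfeldSchinzel1975_theorem1_holds hη

/-- **Siegel-zero quality bound for odd characters, unconditionally**: for `ε > 0` with
`6/π − ε > 0` there is `c` such that every Siegel zero of quality `η` (Tao–Teräväinen) of an odd
character mod `D > c` has `η ≤ √D/((6/π − ε) log D)`.
[cite: GoldfeldSchinzel1975, Corollary p. 572 (case d < 0), §4 p. 582]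
[cite: TaoTeravainen2021, Definition 1.4] -/
theorem IsSiegelZero.quality_le_odd {ε : ℝ} (hε : 0 < ε) (hε' : 0 < 6 / Real.pi - ε) :
    ∃ c : ℕ, ∀ (D : ℕ) [NeZero D], c < D → ∀ (χ : DirichletCharacter ℂ D) (η : ℝ), χ.Odd →
      Literature.Barriers.Parity.IsSiegelZero χ η →
        η ≤ Real.sqrt D / ((6 / Real.pi - ε) * Real.log D) :=
  IsSiegelZero.quality_le_of_theorem1_odd goldfeldSchinzel1975_theorem1_holds hε hε'

/-- **`1 − β ≤ (6/π + η) h(−D)/√D`, unconditionally**, for the real zeros with `1 − β < (log D)⁻²`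
of a primitive quadratic odd `χ` mod `D > c(η)` (`h(−D)` the form class number).
[cite: GoldfeldSchinzel1975, Theorem 1 p. 571 (1)–(2) with §4 p. 582 (L(1,χ) = πh₀/√|d|)] -/
theorem one_sub_le_classNumber {η : ℝ} (hη : 0 < η) :
    ∃ c : ℕ, ∀ (D : ℕ) [NeZero D], c < D →
      ∀ χ : DirichletCharacter ℂ D, χ.IsQuadratic → χ.IsPrimitive → χ.Odd →
        ∀ β : ℝ, χ.LFunction (β : ℂ) = 0 → 1 - β < 1 / Real.log D ^ 2 →
          1 - β ≤ (6 / Real.pi + η) * (BinaryQuadraticForm.classNumber (-(D : ℤ)) : ℝ) /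
            Real.sqrt D :=
  one_sub_le_classNumber_of_theorem1 goldfeldSchinzel1975_theorem1_holds hη

/-- **`1 − β ≤ (6/π + η) h_K/√D`, unconditionally**, with the class number of the imaginary
quadratic field `K`, `d_K = −D`. [cite: GoldfeldSchinzel1975, Theorem 1 p. 571 with §4 p. 582]
[cite: Cox2013, §7.B Thm. 7.7 (ii)] -/
theorem one_sub_le_classNumber_field {η : ℝ} (hη : 0 < η) :
    ∃ c : ℕ, ∀ (D : ℕ) [NeZero D], c < D →
      ∀ χ : DirichletCharacter ℂ D, χ.IsQuadratic → χ.IsPrimitive → χ.Odd →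
        ∀ β : ℝ, χ.LFunction (β : ℂ) = 0 → 1 - β < 1 / Real.log D ^ 2 →
          ∀ (K : Type) [Field K] [NumberField K], Module.finrank ℚ K = 2 →
            NumberField.discr K = -(D : ℤ) →
              1 - β ≤ (6 / Real.pi + η) * (NumberField.classNumber K : ℝ) / Real.sqrt D :=
  one_sub_le_classNumber_field_of_theorem1 goldfeldSchinzel1975_theorem1_holds hη

end Literature.NumberTheory.LFunctions.GoldfeldSchinzel1975

end
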